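import Literature.Probability.RandomPlanarGeometry.LoewnerTransformContinuity
import Literature.Probability.RandomPlanarGeometry.BoundaryCorrespondence
import Literature.Probability.RandomPlanarGeometry.CaratheodoryHalfPlaneProofs
import Literature.Probability.RandomPlanarGeometry.ConformalRestrictionProofs
import HarnessLib

/-!
# Route `SAWReversalUpgrade`, support `FaithfulOfNoReturn` (stmt-CriticalPhenomena-18008):
# the boundary correspondence of a chordal uniformizing map, quantitatively

Helper file (1 of several) for the proof of
`Summit.CriticalPhenomena.SAWScalingLimit.Theses.SAWReversalUpgrade.FaithfulOfNoReturn`.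

For a chordal uniformizing map `φ : ℍₒ → D` of a Dobrushin domain `(D; a, b)` we collect, in the exact
vocabulary of the route's attachment (`φ.boundaryExtension` and its section
`Function.invFunOn φ.boundaryExtension {z | 0 ≤ z.im}`), the consequences of Carathéodory's theorem
(`JordanDomain.exists_isDiscExtension`, `exists_continuousOn_extension_holds`) that the faithfulness proof
consumes:

* `Φ = φ.boundaryExtension` is injective on the closed half-plane `H = {0 ≤ im}` (continuity is the
  tree's `continuousOn_boundaryExtension_im_nonneg`), maps it
  onto `closure D ∖ {b}`, sends `0` to `a`, the open half-plane into `D` and the real line into `∂D`;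
* `ψ = invFunOn Φ H` is a two-sided inverse on `closure D ∖ {b}`, continuous there, `ψ a = 0`;
* quantitative forms: `Φ z → b` uniformly as `‖z‖ → ∞` in `H`; `‖ψ p‖ → ∞` as `p → b`;
  `Φ` is small near `0`, `ψ` is small near `a`; `Φ` is uniformly continuous on `H ∩ closedBall 0 M`.

Everything is elementary given the tree's Carathéodory files; no new definitions.
-/

noncomputable section

open Set Filter Metric Complex Function
open scoped Topology
open UpperHalfPlane (upperHalfPlaneSet)
open Literature.Probability.RandomPlanarGeometry

namespace Summit.CriticalPhenomena.SAWScalingLimit.Theorems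

namespace FaithfulAttach

variable {D : DobrushinDomain} {φ : ConformalEquiv upperHalfPlaneSet D.carrier}

/-! ### The marked points -/

/-- A marked point lies in the closure of the domain. -/
theorem pt_mem_closure (D : DobrushinDomain) (i : Fin 2) : D.pt i ∈ closure D.carrier :=
  frontier_subset_closure (D.pt_mem_frontier i)

/-- The closed upper half-plane is closed. -/
theorem isClosed_H : IsClosed {z : ℂ | 0 ≤ z.im} :=
  isClosed_le continuous_const Complex.continuous_im

/-- `H ∩ closedBall 0 M` is compact. -/
theorem isCompact_H_inter_closedBall (M : ℝ) : IsCompact ({z : ℂ | 0 ≤ z.im} ∩ closedBall 0 M) :=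
  (isCompact_closedBall (0 : ℂ) M).inter_left isClosed_H

/-! ### The boundary extension on the closed half-plane -/

/-- `Φ` maps the closed half-plane into `closure D`. -/
theorem bext_mem_closure (φ : ConformalEquiv upperHalfPlaneSet D.carrier) {z : ℂ} (hz : 0 ≤ z.im) :
    φ.boundaryExtension z ∈ closure D.carrier :=
  JordanDomain.mapsTo_boundaryExtension_holds D.toJordanDomain φ
    (by rw [ConformalEquiv.closure_upperHalfPlaneSet_eq]; exact hz)

/-- `Φ` maps the open half-plane into `D` (it is `φ` there). -/
theorem bext_mem_carrier (φ : ConformalEquiv upperHalfPlaneSet D.carrier) {z : ℂ} (hz : 0 < z.im) :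
    φ.boundaryExtension z ∈ D.carrier := by
  rw [φ.boundaryExtension_eq (show z ∈ upperHalfPlaneSet from hz)]
  exact φ.mapsTo hz

/-- `Φ` maps real points to `∂D`. -/
theorem bext_mem_frontier_of_im_eq_zero (φ : ConformalEquiv upperHalfPlaneSet D.carrier) {z : ℂ}
    (hz : z.im = 0) : φ.boundaryExtension z ∈ frontier D.carrier := by
  obtain ⟨Φ, hΦ⟩ := JordanDomain.exists_isDiscExtension
    JordanDomain.exists_continuousOn_extension_holds φ
  have : z = ((z.re : ℝ) : ℂ) := by
    apply Complex.ext <;> simp [hz]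
  rw [this]
  exact hΦ.boundaryExtension_ofReal_mem_frontier z.re

/-- A point of the closed half-plane is mapped into `D` iff it lies in the open half-plane. -/
theorem bext_mem_carrier_iff (φ : ConformalEquiv upperHalfPlaneSet D.carrier) {z : ℂ} (hz : 0 ≤ z.im) :
    φ.boundaryExtension z ∈ D.carrier ↔ 0 < z.im := by
  refine ⟨fun h => ?_, bext_mem_carrier φ⟩
  rcases hz.lt_or_eq with hlt | heq
  · exact hlt
  · exact absurd (bext_mem_frontier_of_im_eq_zero φ heq.symm) (D.notMem_frontier_of_mem h)

/-- `Φ 0 = a`. -/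
theorem bext_zero (hφ : D.IsChordalUniformizing φ) : φ.boundaryExtension 0 = D.pt 0 :=
  hφ.boundaryExtension_zero

/-- `Φ` is injective on the closed half-plane (the disc extension is a bijection of the closed disc
and the Cayley transform is injective on `H`). -/
theorem bext_injOn (φ : ConformalEquiv upperHalfPlaneSet D.carrier) :
    InjOn φ.boundaryExtension {z : ℂ | 0 ≤ z.im} := by
  obtain ⟨Φ, hΦ⟩ := JordanDomain.exists_isDiscExtension
    JordanDomain.exists_continuousOn_extension_holds φ
  intro z hz w hw h
  rw [mem_setOf_eq] at hz hw
  rw [hΦ.boundaryExtension_eq hz, hΦ.boundaryExtension_eq hw] at h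
  have h1 := hΦ.bijOn.injOn (mem_closedBall_zero_iff.2 (norm_cayleyFun_le_one hz))
    (mem_closedBall_zero_iff.2 (norm_cayleyFun_le_one hw)) h
  have h2 := congrArg cayleyInvFun h1
  rwa [cayleyInvFun_cayleyFun (add_I_ne_zero hz), cayleyInvFun_cayleyFun (add_I_ne_zero hw)] at h2

/-- No point of the closed half-plane is mapped to `b` (the boundary value at `∞`). -/
theorem bext_ne_pt_one (hφ : D.IsChordalUniformizing φ) {z : ℂ} (hz : 0 ≤ z.im) :
    φ.boundaryExtension z ≠ D.pt 1 := by
  obtain ⟨Φ, hΦ⟩ := JordanDomain.exists_isDiscExtension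
    JordanDomain.exists_continuousOn_extension_holds φ
  rw [hΦ.boundaryExtension_eq hz, ← hΦ.apply_one_eq hφ.2]
  intro h
  exact cayleyFun_ne_one z (hΦ.bijOn.injOn (mem_closedBall_zero_iff.2 (norm_cayleyFun_le_one hz))
    (mem_closedBall_zero_iff.2 (by simp)) h)

/-- `Φ z = a` iff `z = 0`, on the closed half-plane. -/
theorem bext_eq_pt_zero_iff (hφ : D.IsChordalUniformizing φ) {z : ℂ} (hz : 0 ≤ z.im) :
    φ.boundaryExtension z = D.pt 0 ↔ z = 0 := by
  refine ⟨fun h => ?_, fun h => h ▸ bext_zero hφ⟩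
  rw [← bext_zero hφ] at h
  exact bext_injOn φ hz (show (0 : ℂ) ∈ {z : ℂ | 0 ≤ z.im} by simp) h

/-- `Φ` is onto `closure D ∖ {b}` from the closed half-plane. -/
theorem bext_surjOn (hφ : D.IsChordalUniformizing φ) :
    SurjOn φ.boundaryExtension {z : ℂ | 0 ≤ z.im} (closure D.carrier \ {D.pt 1}) := by
  obtain ⟨ψ, -, hψ, -, -, -⟩ := hφ.exists_inverse_boundaryExtension
  intro p hp
  exact ⟨ψ p, (hψ p hp).1, (hψ p hp).2⟩

/-! ### The section `ψ = invFunOn Φ H` -/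

/-- `ψ p` lies in the closed half-plane and `Φ (ψ p) = p`, for `p ∈ closure D ∖ {b}`. -/
theorem invFun_spec (hφ : D.IsChordalUniformizing φ) {p : ℂ} (hp : p ∈ closure D.carrier)
    (hpb : p ≠ D.pt 1) :
    0 ≤ (invFunOn φ.boundaryExtension {z : ℂ | 0 ≤ z.im} p).im ∧
      φ.boundaryExtension (invFunOn φ.boundaryExtension {z : ℂ | 0 ≤ z.im} p) = p := by
  have h : ∃ z ∈ {z : ℂ | 0 ≤ z.im}, φ.boundaryExtension z = p := bext_surjOn hφ ⟨hp, hpb⟩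
  exact ⟨invFunOn_mem h, invFunOn_eq h⟩

/-- `ψ (Φ z) = z` on the closed half-plane. -/
theorem invFun_bext (φ : ConformalEquiv upperHalfPlaneSet D.carrier) {z : ℂ} (hz : 0 ≤ z.im) :
    invFunOn φ.boundaryExtension {z : ℂ | 0 ≤ z.im} (φ.boundaryExtension z) = z :=
  (bext_injOn φ).leftInvOn_invFunOn hz

/-- `ψ a = 0`. -/
theorem invFun_pt_zero (hφ : D.IsChordalUniformizing φ) :
    invFunOn φ.boundaryExtension {z : ℂ | 0 ≤ z.im} (D.pt 0) = 0 := by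
  rw [← bext_zero hφ]
  exact invFun_bext φ (by simp)

/-- `ψ p = 0` iff `p = a`, for `p ∈ closure D ∖ {b}`. -/
theorem invFun_eq_zero_iff (hφ : D.IsChordalUniformizing φ) {p : ℂ} (hp : p ∈ closure D.carrier)
    (hpb : p ≠ D.pt 1) :
    invFunOn φ.boundaryExtension {z : ℂ | 0 ≤ z.im} p = 0 ↔ p = D.pt 0 := by
  refine ⟨fun h => ?_, fun h => h ▸ invFun_pt_zero hφ⟩
  have := (invFun_spec hφ hp hpb).2
  rw [h, bext_zero hφ] at this
  exact this.symm

/-- Points of `D` are pulled back into the open half-plane. -/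
theorem invFun_im_pos (hφ : D.IsChordalUniformizing φ) {p : ℂ} (hp : p ∈ D.carrier) :
    0 < (invFunOn φ.boundaryExtension {z : ℂ | 0 ≤ z.im} p).im := by
  have hpb : p ≠ D.pt 1 := fun h => MarkedDomain.pt_notMem_carrier D 1 (h ▸ hp)
  obtain ⟨him, heq⟩ := invFun_spec hφ (subset_closure hp) hpb
  exact (bext_mem_carrier_iff φ him).1 (heq.symm ▸ hp)

/-- `ψ` agrees with the continuous inverse of `exists_inverse_boundaryExtension`, hence is continuous
on `closure D ∖ {b}`. -/
theorem continuousOn_invFun (hφ : D.IsChordalUniformizing φ) :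
    ContinuousOn (invFunOn φ.boundaryExtension {z : ℂ | 0 ≤ z.im}) (closure D.carrier \ {D.pt 1}) := by
  obtain ⟨ψ, hψc, hψ, -, -, -⟩ := hφ.exists_inverse_boundaryExtension
  refine hψc.congr fun p hp => ?_
  have h1 := invFun_spec hφ hp.1 hp.2
  have h2 := hψ p hp
  exact bext_injOn φ h1.1 h2.1 (h1.2.trans h2.2.symm)

/-! ### Quantitative boundary behaviour -/

/-- **`Φ z → b` uniformly as `‖z‖ → ∞` in the closed half-plane.** -/
theorem exists_norm_le_dist_bext_lt (hφ : D.IsChordalUniformizing φ) {κ : ℝ} (hκ : 0 < κ) :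
    ∃ M : ℝ, 0 < M ∧ ∀ z : ℂ, 0 ≤ z.im → M ≤ ‖z‖ → dist (φ.boundaryExtension z) (D.pt 1) < κ := by
  have h : ∀ᶠ z in cocompact ℂ ⊓ 𝓟 {z : ℂ | 0 ≤ z.im},
      dist (φ.boundaryExtension z) (D.pt 1) < κ :=
    hφ.tendsto_boundaryExtension_cocompact (Metric.ball_mem_nhds (D.pt 1) hκ)
  rw [Filter.eventually_inf_principal, Filter.Eventually, Filter.mem_cocompact] at h
  obtain ⟨K, hK, hKsub⟩ := h
  obtain ⟨M, hM⟩ := hK.isBounded.subset_closedBall 0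
  refine ⟨max M 0 + 1, by positivity, fun z hz hMz => ?_⟩
  have hzK : z ∉ K := fun hzK => by
    have := mem_closedBall_zero_iff.1 (hM hzK)
    linarith [le_max_left M 0]
  exact hKsub hzK hz

/-- **`‖ψ p‖ → ∞` as `p → b`**: points of `closure D ∖ {b}` close to `b` have large preimages. -/
theorem exists_dist_lt_le_norm_invFun (hφ : D.IsChordalUniformizing φ) (M : ℝ) :
    ∃ ρ : ℝ, 0 < ρ ∧ ∀ p ∈ closure D.carrier, p ≠ D.pt 1 → dist p (D.pt 1) < ρ →
      M < ‖invFunOn φ.boundaryExtension {z : ℂ | 0 ≤ z.im} p‖ := by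
  set K : Set ℂ := φ.boundaryExtension '' ({z : ℂ | 0 ≤ z.im} ∩ closedBall 0 M) with hK
  have hKc : IsCompact K := (isCompact_H_inter_closedBall M).image_of_continuousOn
    ((continuousOn_boundaryExtension_im_nonneg φ).mono inter_subset_left)
  have hbK : D.pt 1 ∈ Kᶜ := by
    rintro ⟨z, hz, hzb⟩
    exact bext_ne_pt_one hφ hz.1 hzb
  obtain ⟨ρ, hρ, hball⟩ := Metric.isOpen_iff.1 hKc.isClosed.isOpen_compl (D.pt 1) hbK
  refine ⟨ρ, hρ, fun p hp hpb hdist => ?_⟩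
  by_contra hle
  rw [not_lt] at hle
  have hpK : p ∈ K := by
    obtain ⟨him, heq⟩ := invFun_spec hφ hp hpb
    exact ⟨_, ⟨him, mem_closedBall_zero_iff.2 hle⟩, heq⟩
  exact hball (mem_ball.2 hdist) hpK

/-- **`Φ` is small near `0`**: continuity of `Φ` at `0` within the closed half-plane, `Φ 0 = a`. -/
theorem exists_norm_lt_dist_bext_lt (hφ : D.IsChordalUniformizing φ) {κ : ℝ} (hκ : 0 < κ) :
    ∃ ρ : ℝ, 0 < ρ ∧ ∀ z : ℂ, 0 ≤ z.im → ‖z‖ < ρ → dist (φ.boundaryExtension z) (D.pt 0) < κ := by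
  have h0 : (0 : ℂ) ∈ {z : ℂ | 0 ≤ z.im} := by simp
  have hc := Metric.continuousWithinAt_iff.1 (continuousOn_boundaryExtension_im_nonneg φ 0 h0) κ hκ
  obtain ⟨ρ, hρ, h⟩ := hc
  refine ⟨ρ, hρ, fun z hz hzρ => ?_⟩
  rw [← bext_zero hφ]
  exact h hz (by simpa using hzρ)

/-- **`ψ` is small near `a`**: continuity of `ψ` at `a` within `closure D`, `ψ a = 0`. -/
theorem exists_dist_lt_norm_invFun_lt (hφ : D.IsChordalUniformizing φ) {ρ' : ℝ} (hρ' : 0 < ρ') :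
    ∃ ρ : ℝ, 0 < ρ ∧ ∀ p ∈ closure D.carrier, dist p (D.pt 0) < ρ →
      ‖invFunOn φ.boundaryExtension {z : ℂ | 0 ≤ z.im} p‖ < ρ' := by
  have ha : D.pt 0 ∈ closure D.carrier \ {D.pt 1} := ⟨pt_mem_closure D 0, D.pt_injective.ne (by decide)⟩
  obtain ⟨ρ, hρ, h⟩ := Metric.continuousWithinAt_iff.1 (continuousOn_invFun hφ _ ha) ρ' hρ'
  refine ⟨min ρ (dist (D.pt 0) (D.pt 1)), lt_min hρ (dist_pos.2 (D.pt_injective.ne (by decide))), fun p hp hdist => ?_⟩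
  have hpb : p ≠ D.pt 1 := fun h' => by
    rw [h', dist_comm] at hdist
    exact lt_irrefl _ (hdist.trans_le (min_le_right _ _))
  have := h ⟨hp, hpb⟩ (hdist.trans_le (min_le_left _ _))
  rwa [invFun_pt_zero hφ, dist_zero_right] at this

/-- **Uniform continuity of `Φ` on `H ∩ closedBall 0 M`.** -/
theorem exists_unifCont_bext (φ : ConformalEquiv upperHalfPlaneSet D.carrier) (M : ℝ) {κ : ℝ}
    (hκ : 0 < κ) :
    ∃ η : ℝ, 0 < η ∧ ∀ z w : ℂ, 0 ≤ z.im → 0 ≤ w.im → ‖z‖ ≤ M → ‖w‖ ≤ M → dist z w < η →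
      dist (φ.boundaryExtension z) (φ.boundaryExtension w) < κ := by
  have hu := (isCompact_H_inter_closedBall M).uniformContinuousOn_of_continuous
    ((continuousOn_boundaryExtension_im_nonneg φ).mono inter_subset_left)
  obtain ⟨η, hη, h⟩ := Metric.uniformContinuousOn_iff.1 hu κ hκ
  exact ⟨η, hη, fun z w hz hw hzM hwM hd =>
    h z ⟨hz, mem_closedBall_zero_iff.2 hzM⟩ w ⟨hw, mem_closedBall_zero_iff.2 hwM⟩ hd⟩

end FaithfulAttach

end Summit.CriticalPhenomena.SAWScalingLimit.Theorems
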